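import Summits.CriticalPhenomena.PercolationContinuityZ3.Theorems.PercNonProliferationFreeBoxSparseStubCollarUnits

/-!
# Crux `PercNonProliferation.FreeBoxSparse` (stmt-CriticalPhenomena-4445), line `ccfs-window-kissing-walls` —
# registered stub `stub_collarGeom` (piece 1/3 of `stub_collar`): the eight half-shifted tilings

Deterministic geometry.  `L = 4r + 2`.  For a centre `a ∈ ℤ³`, the `r`-ball `box 3 r + a` (side `2r+1 = L/2`)
lies inside ONE tile of the cubic tiling of side `L` with offset `o ∈ {0, 2r+1}³` for a suitable `o = o(a)`
(coordinatewise: the tile of offset `0` containing `a_j + r` either contains `a_j - r` too, or the tile of offset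
`2r+1` one index lower contains the whole interval).  Pigeonhole over the `8` offsets and over the `≤ L³` centres
per tile (`StubCollarAssembly.card_fibre_tile_le`) turns `V` doubly-met centres into `≥ V/(8L³)` distinct tiles
of one tiling each containing a doubly-met ball:  `V ≤ 8 L³ · #{good tiles of o}`.
-/

noncomputable section

namespace Summit.CriticalPhenomena.PercolationContinuityZ3.Theorems.FreeBoxSparse

open MeasureTheory Filter
open Literature.Probability.Percolation Literature.Probability.LatticeModels
open scoped Topology Classical

namespace StubCollarGeomProof

/-- Membership in a translated ball, coordinatewise. [folklore] -/
theorem mem_ball_iff {r : ℕ} {a z : Site 3} :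
    z ∈ (box 3 r).image (· + a) ↔ ∀ j, a j - r ≤ z j ∧ z j ≤ a j + r := by
  constructor
  · rintro hz j
    obtain ⟨w, hw, rfl⟩ := Finset.mem_image.1 hz
    have := (mem_box.1 hw) j
    simp only [Pi.add_apply]
    omega
  · intro h
    refine Finset.mem_image.2 ⟨z - a, ?_, sub_add_cancel z a⟩
    rw [mem_box]
    intro j
    have := h j
    simp only [Pi.sub_apply]
    omega

/-- **One coordinate**: an interval of `2r+1` consecutive integers lies in one tile of side `L = 4r+2` for the
offset `0` or for the offset `2r+1`. Returns the offset `c` and the tile index `ι` with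
`ι L + c ≤ t ≤ ι L + c + L - 1` on the interval. [folklore] -/
theorem exists_offset_coord (r : ℕ) (m : ℤ) :
    ∃ c ι : ℤ, (c = 0 ∨ c = 2 * (r : ℤ) + 1) ∧
      ∀ t : ℤ, m - r ≤ t → t ≤ m + r → ι * (4 * (r : ℤ) + 2) + c ≤ t ∧ t < ι * (4 * (r : ℤ) + 2) + c + (4 * (r : ℤ) + 2) := by
  set L : ℤ := 4 * (r : ℤ) + 2 with hL
  have hL0 : 0 < L := by rw [hL]; positivity
  set k : ℤ := (m + r) / L with hk
  have hk1 : L * k ≤ m + r := Int.mul_ediv_self_le hL0.ne'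
  have hk2 : m + r < L * k + L := Int.lt_mul_ediv_self_add hL0
  by_cases h : L * k ≤ m - r
  · refine ⟨0, k, Or.inl rfl, fun t ht1 ht2 => ⟨?_, ?_⟩⟩ <;> nlinarith [mul_comm L k]
  · push Not at h
    refine ⟨2 * (r : ℤ) + 1, k - 1, Or.inr rfl, fun t ht1 ht2 => ⟨?_, ?_⟩⟩
    · have : (k - 1) * L = L * k - L := by ring
      rw [this, hL] at *
      omega
    · have : (k - 1) * L = L * k - L := by ring
      rw [this, hL] at *
      omega

/-- Tile index from the tile inequalities: `ι L + c ≤ t < ι L + c + L` gives `(t - c) / L = ι`. [folklore] -/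
theorem ediv_eq_of_mem_tile {L c ι t : ℤ} (hL : 0 < L) (h1 : ι * L + c ≤ t) (h2 : t < ι * L + c + L) :
    (t - c) / L = ι := by
  have h := (Int.ediv_emod_unique (a := t - c) (b := L) (r := t - c - ι * L) (q := ι) hL).2
    ⟨by ring, by linarith, by linarith⟩
  exact h.1

/-- **Every `r`-ball lies in one tile of one of the eight half-shifted tilings.** [folklore] -/
theorem exists_offset (r : ℕ) (a : Site 3) :
    ∃ o ι : Fin 3 → ℤ, (∀ j, o j = 0 ∨ o j = 2 * (r : ℤ) + 1) ∧
      ∀ z ∈ (box 3 r).image (· + a), (fun j => (z j - o j) / (4 * (r : ℤ) + 2)) = ι := by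
  choose c ι hc hcι using fun j : Fin 3 => exists_offset_coord r (a j)
  refine ⟨c, ι, hc, fun z hz => ?_⟩
  funext j
  obtain ⟨h1, h2⟩ := (mem_ball_iff.1 hz) j
  obtain ⟨h3, h4⟩ := hcι j (z j) h1 h2
  exact ediv_eq_of_mem_tile (by positivity) h3 h4

end StubCollarGeomProof

open StubCollarGeomProof in
/-- **Registered stub `stub_collarGeom`** (piece 1/3 of `stub_collar`, line `ccfs-window-kissing-walls`): for every
finite `Λ`, configuration `ω`, roots `x, y` and radius `r`, one of the eight offsets `o ∈ {0, 2r+1}³` has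
`V ≤ 8 (4r+2)³ · T_o`, where `V` is the number of doubly-met centres (`a ∈ Λ`, `box 3 r + a ⊆ Λ`, the ball met
by both pieces within sup-distance `r`) and `T_o` is the number of tile indices of the tiling of side `4r+2` and
offset `o` whose tile contains such a doubly-met ball. Pigeonhole twice: over the offset `o(a)` of each centre
(`exists_offset`), then over the `≤ (4r+2)³` centres per tile (`StubCollarAssembly.card_fibre_tile_le`). [folklore] -/
theorem stub_collarGeom :
    ∀ (r : ℕ) (Λ : Finset (Site 3)) (ω : BondConfig (Site 3)) (x y : Site 3), ∃ o : Fin 3 → ℤ, (∀ j, o j = 0 ∨ o j = 2 * (r : ℤ) + 1) ∧ (Set.ncard {a : Site 3 | a ∈ Λ ∧ (box 3 r).image (· + a) ⊆ Λ ∧ (∃ u ∈ Λ, (Finset.univ.sup fun j : Fin 3 => (u j - a j).natAbs) ≤ r ∧ ω ∈ openConnIn ↑Λ x u) ∧ (∃ u ∈ Λ, (Finset.univ.sup fun j : Fin 3 => (u j - a j).natAbs) ≤ r ∧ ω ∈ openConnIn ↑Λ y u)} : ℝ) ≤ 8 * (4 * (r : ℝ) + 2) ^ 3 * (Set.ncard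 {ι : Site 3 | ∃ a : Site 3, (box 3 r).image (· + a) ⊆ Λ ∧ (∀ z ∈ (box 3 r).image (· + a), (fun j => (z j - o j) / (4 * (r : ℤ) + 2)) = ι) ∧ (∃ u ∈ Λ, (Finset.univ.sup fun j : Fin 3 => (u j - a j).natAbs) ≤ r ∧ ω ∈ openConnIn ↑Λ x u) ∧ (∃ u ∈ Λ, (Finset.univ.sup fun j : Fin 3 => (u j - a j).natAbs) ≤ r ∧ ω ∈ openConnIn ↑Λ y u)} : ℝ) := by
  intro r Λ ω x y
  -- abbreviations (inside the proof only)
  set Px : Site 3 → Prop := fun a => ∃ u ∈ Λ, (Finset.univ.sup fun j : Fin 3 => (u j - a j).natAbs) ≤ r ∧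
    ω ∈ openConnIn ↑Λ x u with hPx
  set Py : Site 3 → Prop := fun a => ∃ u ∈ Λ, (Finset.univ.sup fun j : Fin 3 => (u j - a j).natAbs) ≤ r ∧
    ω ∈ openConnIn ↑Λ y u with hPy
  set L : ℤ := 4 * (r : ℤ) + 2 with hL
  have hL0 : 0 < L := by rw [hL]; positivity
  -- per-centre offset and tile index
  choose o ι ho hι using fun a : Site 3 => exists_offset r a
  -- the centres as a Finset
  set SF : Finset (Site 3) := Λ.filter fun a => (box 3 r).image (· + a) ⊆ Λ ∧ Px a ∧ Py a with hSF
  have hS : {a : Site 3 | a ∈ Λ ∧ (box 3 r).image (· + a) ⊆ Λ ∧ Px a ∧ Py a} = ↑SF := by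
    ext a; simp [hSF]
  -- the offsets
  set O : Finset (Fin 3 → ℤ) := Fintype.piFinset (fun _ : Fin 3 => ({0, 2 * (r : ℤ) + 1} : Finset ℤ)) with hO
  have hoO : ∀ a, o a ∈ O := fun a => by
    rw [hO, Fintype.mem_piFinset]; intro j; rcases ho a j with h | h <;> simp [h]
  have hOcard : (O.card : ℝ) ≤ 8 := by
    have h8 : O.card ≤ 8 := by
      rw [hO, Fintype.card_piFinset, Finset.prod_const, Finset.card_univ, Fintype.card_fin]
      calc (({0, 2 * (r : ℤ) + 1} : Finset ℤ)).card ^ 3 ≤ 2 ^ 3 := Nat.pow_le_pow_left Finset.card_le_two 3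
        _ = 8 := by norm_num
    exact_mod_cast h8
  have hOne : O.Nonempty := ⟨o 0, hoO 0⟩
  -- pigeonhole over offsets: some `o₀` carries at least `|SF|/|O|` centres
  obtain ⟨o₀, ho₀, hfib⟩ : ∃ o₀ ∈ O, (SF.card : ℝ) ≤ O.card * ((SF.filter fun a => o a = o₀).card : ℝ) := by
    have hsum : SF.card = ∑ b ∈ O, (SF.filter fun a => o a = b).card :=
      Finset.card_eq_sum_card_fiberwise fun a _ => Finset.mem_coe.2 (hoO a)
    refine Finset.exists_le_of_sum_le hOne (le_of_eq ?_)
    rw [Finset.sum_const, nsmul_eq_mul, ← Finset.mul_sum]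
    congr 1
    exact_mod_cast hsum
  refine ⟨o₀, fun j => ?_, ?_⟩
  · -- `o₀` is an offset
    have := (Fintype.mem_piFinset.1 (hO ▸ ho₀)) j
    simpa [Finset.mem_insert, Finset.mem_singleton] using this
  -- good tiles of `o₀` ⊇ the tile indices of the centres with offset `o₀`
  set SF₀ : Finset (Site 3) := SF.filter fun a => o a = o₀ with hSF₀
  set T : Set (Site 3) := {κ : Site 3 | ∃ a : Site 3, (box 3 r).image (· + a) ⊆ Λ ∧
      (∀ z ∈ (box 3 r).image (· + a), (fun j => (z j - o₀ j) / (4 * (r : ℤ) + 2)) = κ) ∧ Px a ∧ Py a} with hT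
  have hTfin : T.Finite := by
    refine (Λ.image fun z : Site 3 => (fun j => (z j - o₀ j) / (4 * (r : ℤ) + 2))).finite_toSet.subset ?_
    rintro κ ⟨a, hball, hidx, -, -⟩
    have ha : a ∈ Λ := hball (StubCollarAssembly.self_mem_ball r a)
    rw [Finset.coe_image]
    exact ⟨a, ha, hidx a (StubCollarAssembly.self_mem_ball r a)⟩
  have himg : ↑(SF₀.image ι) ⊆ T := by
    intro κ hκ
    rw [Finset.coe_image] at hκ
    obtain ⟨a, ha, rfl⟩ := hκ
    rw [Finset.mem_coe, hSF₀, Finset.mem_filter, hSF, Finset.mem_filter] at ha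
    obtain ⟨⟨-, hball, hPa, hQa⟩, hoa⟩ := ha
    refine ⟨a, hball, fun z hz => ?_, hPa, hQa⟩
    rw [← hoa]; exact hι a z hz
  -- fibres of `ι` on `SF₀` have at most `L³` centres (a centre lies in its own ball, hence in its tile)
  have hfibre : ∀ κ ∈ SF₀.image ι, (SF₀.filter fun a => ι a = κ).card ≤ L.toNat ^ 3 := by
    intro κ _
    refine le_trans (Finset.card_le_card ?_) (StubCollarAssembly.card_fibre_tile_le hL0 o₀ κ Λ)
    intro a ha
    rw [Finset.mem_filter] at ha ⊢
    obtain ⟨ha0, hκ⟩ := ha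
    rw [hSF₀, Finset.mem_filter, hSF, Finset.mem_filter] at ha0
    obtain ⟨⟨haΛ, -, -, -⟩, hoa⟩ := ha0
    refine ⟨haΛ, ?_⟩
    rw [← hκ, ← hoa]
    exact hι a a (StubCollarAssembly.self_mem_ball r a)
  have hcount : SF₀.card ≤ L.toNat ^ 3 * (SF₀.image ι).card := Finset.card_le_mul_card_image SF₀ _ hfibre
  -- assemble the inequality
  have hLnat : (L.toNat : ℝ) = 4 * (r : ℝ) + 2 := by
    have : L.toNat = 4 * r + 2 := by rw [hL]; omega
    rw [this]; push_cast; ring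
  have h1 : (SF₀.card : ℝ) ≤ (4 * (r : ℝ) + 2) ^ 3 * ((SF₀.image ι).card : ℝ) := by
    have := hcount; rw [← hLnat]; exact_mod_cast this
  have h2 : ((SF₀.image ι).card : ℝ) ≤ (T.ncard : ℝ) := by
    have := Set.ncard_le_ncard himg hTfin
    rw [Set.ncard_coe_finset] at this
    exact_mod_cast this
  rw [hS, Set.ncard_coe_finset]
  calc (SF.card : ℝ) ≤ O.card * (SF₀.card : ℝ) := hfib
    _ ≤ 8 * (SF₀.card : ℝ) := by gcongr
    _ ≤ 8 * ((4 * (r : ℝ) + 2) ^ 3 * ((SF₀.image ι).card : ℝ)) := by gcongr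
    _ ≤ 8 * ((4 * (r : ℝ) + 2) ^ 3 * (T.ncard : ℝ)) := by gcongr
    _ = 8 * (4 * (r : ℝ) + 2) ^ 3 * (T.ncard : ℝ) := by ring

end Summit.CriticalPhenomena.PercolationContinuityZ3.Theorems.FreeBoxSparse

end
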